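/-
Copyright (c) 2026 the pub-hodgecm-mathlib formalisation cell (harness21).  Prover seat hodgecm-mathlib-K2E4-p14 (g7), Track B ∕ K2-LIT, h413 =
`stmt-HodgeConjecture-24833`, line `K2_E1_TraceFormulaBeta`, road (ρ2) «G7 PROPER», file (R-c) (dealer K2E1-plan (g5), RULING «(ρ2b) = G7 PROPER» 2026-09-04T08:48:57Z (2),
DEAL 08:53:27Z): CUSP FORMS WITH A DECAY LETTER HAVE MEAN ZERO on `U(1,1)(L⁺)∖U(1,1)(𝔸_{L⁺})`, by dominated convergence against the residue of the spherical Eisenstein series.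
-/
import Summits.HodgeConjecture.HodgeConjecture.Theorems.K2E1ResidueUniformMajorantCMTwo        -- ★ (R-b) p858880 (this seat): the `(σ, g)`-uniform majorant; brings ★ p858453, ★ BL-R1, ★ Godement CM-two
import Summits.HodgeConjecture.HodgeConjecture.Theorems.K2E1SphericalEisensteinContinuationCMTwo -- ★ capstone p858603 (K2E4-p14 g6): `(z−1)Ẽ_g(z) → φ₀·r ≠ 0`, `Ẽ_g = E` on `Re z > 1`
import Summits.HodgeConjecture.HodgeConjecture.Theorems.K2E1BLEisensteinInWeightedSpaceU2      -- ★ P7 FILE B p858763 (K2E4-p23 g0): `hL1` from the X-side letter, `β` exists; brings ★ FILE A p858675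
import Summits.HodgeConjecture.HodgeConjecture.Theorems.K2E1CuspConditionDictionaryU          -- ★ (β1) p858735 (K2E4-p23 g0): `invQuot_package_of_mem_cuspForms`; brings `supHeight`, `cuspForms`
import Summits.HodgeConjecture.HodgeConjecture.Theorems.K2E1BLIotaWeightBoundU2               -- ★ (K2E1-p08 g6): `ciSup_borelHeight_toAdelic_mul_eq` (`supHeight x = w₁((out x)⁻¹)`)
import Summits.HodgeConjecture.HodgeConjecture.Theorems.K2E1UnipotentHaarNormalisationU2      -- ★ (D1-a): `isInvInvariant_of_isHaarMeasure_two`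
import HarnessLib

/-!
# K2·E1 — `K2E1CuspFormsMeanZeroDecayingCMTwo` (road (ρ2) «G7 PROPER», file (R-c)): A CUSP FORM OF `U(1,1)_{L∕L⁺}` WITH A DECAY LETTER HAS MEAN ZERO,
# `∫_X φ dμ = 0` — THE RESIDUE `r ≠ 0` OF THE SPHERICAL EISENSTEIN SERIES AT `z = 2ρ_H = 1` TESTED AGAINST `φ` BY DOMINATED CONVERGENCE

Track B ∕ K2-LIT, crux h413 = `stmt-HodgeConjecture-24833`, route of record `HCCMUnconditional`; cell `hodgecm-mathlib`, squad K2, ENGINE E1.  Prover seat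
`hodgecm-mathlib-K2E4-p14` (g7).  THEOREMS ONLY (no `def`, no `instance`, no notation, no named-fact hypothesis, no `sorry`); lane `--supports stmt-HodgeConjecture-24833
--as helper` (count-neutral).  Closes no socket.

THE POINT («(ρ2b) = G7 PROPER», RULING 08:48:57Z): «cusp forms have mean zero», `𝟙 ⟂ L²_cusp`, IS «the constants are residual» — Langlands' identification of the residue of the
spherical Eisenstein series at `z = 2ρ_H` with the constant function, tested against cusp forms.  For the CM pair `(L⁺, L)`, `G = U(J₂)`, `X = G(𝔸_{L⁺}) ⧸ G(L⁺)` with an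
automorphic measure `μ`, and `φ ∈ cuspForms μ 𝔓` (★ trunk: continuous, `L²`, every constant term along the radical `𝔓.radical i = N(𝔸)` vanishes) carrying the ONE decay letter
`Integrable (w₁^A·‖φ‖) μ` for some `A > 1` (`w₁ = supHeight` ★ D5; paid by rapid decay ∕ the K1 estimate for smoothed cusp forms — (R-d)):
(1) «`E ⊥ cusp`» for every REAL `σ ∈ (1, 1+η]`: `∫_X E(H^σ)(x̃⁻¹)·conj φ(x) dμ(x) = 0` — ★ P7 FILE A `integral_quotFun_eisensteinSeriesU_mul_conj_eq_zero_two` at `Λ = invQuot φ` (★ (β1):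
Borel, left-`G(F)`-invariant, `quotFun Λ = φ`, `Λ_B ≡ 0`), its `L¹` letter `hL1` discharged by ★ P7 FILE B §2 from the X-side letter `hX`, and `hX` DISCHARGED HERE from ★ (R-b):
`Σ_q H(γ̃_q g)^σ ≤ C∕(σ−1)·w₁(g)^A` and `w₁((out x)⁻¹) = supHeight x` (★ `ciSup_borelHeight_toAdelic_mul_eq`), so `∫⁻_X (Σ_q‖H(q̃x̃⁻¹)^σ‖)·‖φ‖ ≤ C∕(σ−1)·∫ w₁^A‖φ‖ < ∞`;
(2) DOMINATED CONVERGENCE along `σ → 1⁺` (Mathlib `tendsto_integral_filter_of_dominated_convergence` on the countably generated filter `𝓝[>] 1`): the integrands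
`F_σ(x) = (σ−1)·E(H^σ)(x̃⁻¹)·conj φ(x)` are dominated by `C·w₁^A·‖φ‖` (★ (R-b) `residue_uniform_majorant_cm_two`, uniform in `σ` AND `x`) and converge pointwise to `r·conj φ(x)`
(★ capstone `sphericalEisenstein_continuation_cm_two`: `(z−1)Ẽ_g(z) → r`, `Ẽ_g(σ) = E(H^σ)(g)` for `σ > 1`, composed with `ofReal : 𝓝[>]1 → 𝓝[≠]1`); hence
`r·conj(∫_X φ dμ) = lim_{σ→1⁺} ∫_X F_σ dμ = lim 0 = 0`, and `r ≠ 0` (★ W5-B) gives **`∫_X φ dμ = 0`**.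
* §1 `tsum_enorm_flatSectionU_one_eq_ofReal` — the coset sum of ★ FILE B's letter in Track A's index equals `ofReal (Σ_q H(γ̃_q g)^σ)` in p08's index (★ `K2E1BorelCosetsDictionary` κ).
* §2 `supHeight_eq_ciSup_out_inv` (`supHeight x = w₁((out x)⁻¹)`), `tendsto_ofReal_nhdsGT_one` (`ofReal : 𝓝[>]1 → 𝓝[≠]1`), `tendsto_sub_one_mul_eisensteinSeriesU_nhdsGT_one` (the pointwise
  limit `(σ−1)E(H^σ)(g) → 1·r` along the reals).
* §3 `lintegral_tsum_enorm_mul_lt_top_of_majorant` — the X-side letter `hX` from a majorant `(σ−1)·‖E(H^σ)(g)‖ ≤ C·w₁(g)^A` and the decay letter.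
* §4 **`integral_quotFun_eisensteinSeriesU_mul_conj_eq_zero_of_mem_cuspForms`** — step (1): integrability AND vanishing of `∫_X E(H^σ)(x̃⁻¹)·conj φ dμ` for `σ ∈ (1,1+η]` from the decay letter.
* §5 HEAD **`integral_eq_zero_of_mem_cuspForms_of_decay_cm_two`** — step (2): `∫_X φ dμ = 0`.
* §6 (ED. 2) the same two theorems under the MINIMAL hypotheses `Continuous φ` + `ConstantTermVanishes 𝔓 φ i` (no `L²`, no other indices) — the shape (R-d) feeds with SMOOTHED cusp
  forms: `…_of_constantTermVanishes`, **`integral_eq_zero_of_constantTermVanishes_of_decay_cm_two`**.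
LETTERS (honest): the decay letter `hdec` (dischargeable, (R-d)); the instance letter «an inversion-invariant Haar measure `ν_G` on `G(𝔸)`» of ★ FILE A (data, any one works); `δ, ν, 𝓕`
are data choices.  Typed on Mok's `quasiSplit L⁺ L c 2` with ABSTRACT parabolic data `𝔓 + h𝔓` ((β1)'s J-DATUM ruling: the one `subst` to `cmDatum ∕ cmParabolicData` is not repeated here).
HONEST LABEL: HC_CM is proved only modulo the 7 printed citations (2 remaining named inputs: hLiu418 = `stmt-HodgeConjecture-24832`, h413 = `stmt-HodgeConjecture-24833`) until rung 0
closes; this file asserts no named fact and closes no socket.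
References: [MoeglinWaldspurger1995] I.2.18, II.1.7–II.1.8, IV.1.9–IV.1.11 · [Langlands1976] §7 (the constant as the residue of the minimal-parabolic Eisenstein series) · [Garrett2018] §1.11–§1.12,
§2.8 · [BorelJacquet1979] §4.4–§4.6 · [BernsteinLapid2019] §4 Claim 2.
-/

set_option autoImplicit false
-- the mandated namespace repeats the single-problem summit's segment (`HodgeConjecture.HodgeConjecture`)
set_option linter.dupNamespace false

noncomputable section

open MeasureTheory Measure NumberField IsDedekindDomain Set Filter Module MulAction
open scoped ENNReal NNReal Topology Classical ComplexConjugate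
open Literature.MeasureTheory.Group Literature.NumberTheory
open Literature.NumberTheory.Automorphic Literature.NumberTheory.Automorphic.UnitaryGroup AdelicGroupData
open Summit.HodgeConjecture.HodgeConjecture.Cruxes.H413.K2E1BorelEisensteinU
open Summit.HodgeConjecture.HodgeConjecture.Cruxes.H413.K2E1MaassSelbergBracketsThree (measurable_flatSectionU)
open Summit.HodgeConjecture.HodgeConjecture.Cruxes.H413.K2E1BorelCosetsDictionary (exists_equiv_arithmeticBorelQuot apply_out_eq)
open Summit.HodgeConjecture.HodgeConjecture.Cruxes.H413.K2E1BorelEisensteinGodementCMTwo (summable_borelHeight_rpow_cm_two)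
open Summit.HodgeConjecture.HodgeConjecture.Cruxes.H413.K2E1BLSpacesU2Defs (supHeight)
open Summit.HodgeConjecture.HodgeConjecture.Cruxes.H413.K2E1BLIotaWeightBoundU2 (ciSup_borelHeight_toAdelic_mul_eq)
open Summit.HodgeConjecture.HodgeConjecture.Cruxes.H413.K2E1CuspConditionDictionaryU (invQuot_package_of_mem_cuspForms)
open Summit.HodgeConjecture.HodgeConjecture.Cruxes.H413.K2E1BLEisensteinCuspOrthogonalU (integrable_and_integral_quotFun_eisensteinSeriesU_mul_conj_eq_two integral_quotFun_eisensteinSeriesU_mul_conj_eq_zero_two)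
open Summit.HodgeConjecture.HodgeConjecture.Cruxes.H413.K2E1BLEisensteinInWeightedSpaceU2 (lintegral_weight_enorm_mul_lt_top_of_lintegral_quotient_lt_top exists_isCoveringWeight_arithmeticBorel)
open Summit.HodgeConjecture.HodgeConjecture.Cruxes.H413.K2E1UnipotentHaarNormalisationU2 (isInvInvariant_of_isHaarMeasure_two)
open Summit.HodgeConjecture.HodgeConjecture.Cruxes.H413.K2E1ResidueUniformMajorantCMTwo (residue_uniform_majorant_cm_two norm_eisensteinSeriesU_flatSectionU_const_ofReal tsum_borelHeight_rpow_nonneg)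
open Summit.HodgeConjecture.HodgeConjecture.Cruxes.H413.K2E1SphericalEisensteinContinuationCMTwo (sphericalEisenstein_continuation_cm_two)

namespace Summit.HodgeConjecture.HodgeConjecture.Cruxes.H413.K2E1CuspFormsMeanZeroDecayingCMTwo

variable (L : Type) [Field L] [NumberField L] [IsCMField L]

/-! ## §1 The coset sum of FILE B's letter, in p08's index: `Σ'_{q ∈ B(F)∖G(F)} ‖H(q̃ g)^σ‖ₑ = ofReal (Σ_q H(γ̃_q g)^σ)` -/

/-- **Track A's coset sum of `‖f_σ‖ₑ` is `ofReal` of p08's positive series** (`σ > 1`): re-index along ★ `exists_equiv_arithmeticBorelQuot` (terms match by ★ `apply_out_eq`, `f_σ` being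
left-`B(F)`-invariant ★ `K2E1TruncatedEisensteinExplicit.borelHeight_arithmeticBorel_mul`), `‖f_σ(y)‖ = H(y)^σ` (★ `norm_flatSectionU`), and `ENNReal.ofReal_tsum_of_nonneg` with ★ Godement CM-two summability.
[cite: MoeglinWaldspurger1995, II.1.5] [cite: Garrett2018, §2.10] -/
theorem tsum_enorm_flatSectionU_one_eq_ofReal {σ : ℝ} (hσ : 1 < σ) (g : (quasiSplit (↥(maximalRealSubfield L)) L (IsCMField.complexConj L) 2).Adelic) :
    ∑' q : Quotient (QuotientGroup.rightRel (arithmeticBorel (↥(maximalRealSubfield L)) L (IsCMField.complexConj L) 2)), ‖(flatSectionU (fun _ : (quasiSplit (↥(maximalRealSubfield L)) L (IsCMField.complexConj L) 2).Adelic => (1 : ℂ)) ((σ : ℝ) : ℂ)) (((q.out : (quasiSplit (↥(maximalRealSubfield L)) L (IsCMField.complexConj L) 2).arithmeticSubgroup) : (quasiSplit (↥(maximalRealSubfield L)) L (IsCMField.complexConj L) 2).Adelic) * g)‖ₑ = ENNReal.ofReal (∑' q : Quotient (MulAction.orbitRel ↥(borelU ((IsCMField.complexConj L : L ≃ₐ[↥(maximalRealSubfield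 L)] L) : L →+* L) ((StdForm.antidiagonal 2).over L)) ↥(unitaryGroupOfForm ((IsCMField.complexConj L : L ≃ₐ[↥(maximalRealSubfield L)] L) : L →+* L) ((StdForm.antidiagonal 2).over L))), ((borelHeight (((quasiSplit (↥(maximalRealSubfield L)) L (IsCMField.complexConj L) 2).toAdelic (Quotient.out q : ↥(unitaryGroupOfForm ((IsCMField.complexConj L : L ≃ₐ[↥(maximalRealSubfield L)] L) : L →+* L) ((StdForm.antidiagonal 2).over L)))) * (g)) : ℝ)) ^ σ) := by
  obtain ⟨κ, hκ⟩ := exists_equiv_arithmeticBorelQuot (F := (↥(maximalRealSubfield L))) (E := L) (c := (IsCMField.complexConj L)) (N := 2)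
  have hfB : ∀ b ∈ arithmeticBorel (↥(maximalRealSubfield L)) L (IsCMField.complexConj L) 2, ∀ x : (quasiSplit (↥(maximalRealSubfield L)) L (IsCMField.complexConj L) 2).Adelic, ‖(flatSectionU (fun _ : (quasiSplit (↥(maximalRealSubfield L)) L (IsCMField.complexConj L) 2).Adelic => (1 : ℂ)) ((σ : ℝ) : ℂ)) ((b : (quasiSplit (↥(maximalRealSubfield L)) L (IsCMField.complexConj L) 2).Adelic) * x)‖ₑ = ‖(flatSectionU (fun _ : (quasiSplit (↥(maximalRealSubfield L)) L (IsCMField.complexConj L) 2).Adelic => (1 : ℂ)) ((σ : ℝ) : ℂ)) x‖ₑ := fun b hb x => by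
    rw [flatSectionU_apply, flatSectionU_apply, K2E1TruncatedEisensteinExplicit.borelHeight_arithmeticBorel_mul hb]
  rw [← κ.tsum_eq, ENNReal.ofReal_tsum_of_nonneg (fun _ => Real.rpow_nonneg (NNReal.coe_nonneg _) _) (summable_borelHeight_rpow_cm_two L hσ g)]
  refine tsum_congr fun q => ?_
  rw [apply_out_eq (ψ := fun y : (quasiSplit (↥(maximalRealSubfield L)) L (IsCMField.complexConj L) 2).Adelic => ‖(flatSectionU (fun _ : (quasiSplit (↥(maximalRealSubfield L)) L (IsCMField.complexConj L) 2).Adelic => (1 : ℂ)) ((σ : ℝ) : ℂ)) y‖ₑ) hfB κ hκ q g, ← ofReal_norm, norm_flatSectionU, norm_one, one_mul, Complex.ofReal_re]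

/-! ## §2 `supHeight` in (R-b)'s spelling, and the pointwise limit along the reals: `(σ − 1)·E(H^σ)(g) → 1·r` as `σ → 1⁺` -/

/-- **`supHeight x = w₁((out x)⁻¹)`** in (R-b)'s spelling (★ `ciSup_borelHeight_toAdelic_mul_eq` at `y = (out x)⁻¹`). [cite: BernsteinLapid2019, §4 (p. 10)] -/
theorem supHeight_eq_ciSup_out_inv (x : (quasiSplit (↥(maximalRealSubfield L)) L (IsCMField.complexConj L) 2).automorphicQuotient) : (supHeight (↥(maximalRealSubfield L)) L (IsCMField.complexConj L) 2 (x)) = (⨆ γ : (quasiSplit (↥(maximalRealSubfield L)) L (IsCMField.complexConj L) 2).arithmeticSubgroup, borelHeight ((γ : (quasiSplit (↥(maximalRealSubfield L)) L (IsCMField.complexConj L) 2).Adelic) * (((Quotient.out (x) : (quasiSplit (↥(maximalRealSubfield L)) L (IsCMField.complexConj L) 2).Adelic))⁻¹))) :=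
  ciSup_borelHeight_toAdelic_mul_eq _

/-- `ofReal : ℝ → ℂ` maps `𝓝[>] 1` into `𝓝[≠] 1`. [folklore] -/
theorem tendsto_ofReal_nhdsGT_one : Tendsto (fun σ : ℝ => (σ : ℂ)) (𝓝[>] (1 : ℝ)) (𝓝[≠] (1 : ℂ)) := by
  refine tendsto_nhdsWithin_of_tendsto_nhds_of_eventually_within _ ?_ ?_
  · have h := (Complex.continuous_ofReal.tendsto (1 : ℝ)).mono_left (nhdsWithin_le_nhds (s := Ioi (1 : ℝ)))
    rwa [Complex.ofReal_one] at h
  · exact eventually_nhdsWithin_of_forall fun σ (hσ : 1 < σ) => by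
      rw [mem_compl_singleton_iff]
      exact_mod_cast hσ.ne'

/-- **THE POINTWISE LIMIT ALONG THE REALS**: if `Ẽ` agrees with `σ ↦ E(H^σ)(g)` for `σ > 1` and `(z − 1)·Ẽ(z) → ℓ` on `𝓝[≠] 1` (★ capstone), then `(σ − 1)·E(H^σ)(g) → ℓ` as `σ → 1⁺`.
[cite: MoeglinWaldspurger1995, IV.1.9] -/
theorem tendsto_sub_one_mul_eisensteinSeriesU_nhdsGT_one {g : (quasiSplit (↥(maximalRealSubfield L)) L (IsCMField.complexConj L) 2).Adelic} {Ec : ℂ → ℂ} {ℓ : ℂ}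
    (hb : ∀ z : ℂ, 1 < z.re → Ec z = eisensteinSeriesU (flatSectionU (fun _ : (quasiSplit (↥(maximalRealSubfield L)) L (IsCMField.complexConj L) 2).Adelic => (1 : ℂ)) z) g)
    (hlim : Tendsto (fun z : ℂ => (z - 1) * Ec z) (𝓝[≠] 1) (𝓝 ℓ)) :
    Tendsto (fun σ : ℝ => (((σ : ℝ) : ℂ) - 1) * eisensteinSeriesU (flatSectionU (fun _ : (quasiSplit (↥(maximalRealSubfield L)) L (IsCMField.complexConj L) 2).Adelic => (1 : ℂ)) ((σ : ℝ) : ℂ)) g) (𝓝[>] (1 : ℝ)) (𝓝 ℓ) := by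
  refine (hlim.comp (tendsto_ofReal_nhdsGT_one)).congr' (eventually_nhdsWithin_of_forall fun σ (hσ : 1 < σ) => ?_)
  show ((σ : ℂ) - 1) * Ec σ = ((σ : ℂ) - 1) * eisensteinSeriesU (flatSectionU (fun _ : (quasiSplit (↥(maximalRealSubfield L)) L (IsCMField.complexConj L) 2).Adelic => (1 : ℂ)) ((σ : ℝ) : ℂ)) g
  rw [hb _ (by rwa [Complex.ofReal_re])]

/-! ## §3 The X-side letter `hX` of ★ FILE B from a majorant and the decay letter -/

/-- **THE X-SIDE LETTER FROM A MAJORANT.**  If `(σ−1)·‖E(H^σ)(g)‖ ≤ C·w₁(g)^A` for all `g` (`σ > 1`, `C ≥ 0`) and `w₁^A·‖φ‖` is `μ`-integrable on `X`, then for every `Λ` on `G(𝔸)` descending to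
`φ` (`quotFun Λ = φ`): `∫⁻_X (Σ'_q ‖H(q̃ x̃⁻¹)^σ‖ₑ)·‖Λ(x̃⁻¹)‖ₑ dμ ≤ ∫⁻ ‖C∕(σ−1)·(w₁^A‖φ‖)‖ₑ < ∞` — ★ FILE B's `hX` for `f = H^σ`. [cite: MoeglinWaldspurger1995, II.1.7] [cite: Garrett2018, §2.8] -/
theorem lintegral_tsum_enorm_mul_lt_top_of_majorant {σ C A : ℝ} (hσ : 1 < σ) (hC : 0 ≤ C)
    (hmaj : ∀ g : (quasiSplit (↥(maximalRealSubfield L)) L (IsCMField.complexConj L) 2).Adelic, (σ - 1) * ‖eisensteinSeriesU (flatSectionU (fun _ : (quasiSplit (↥(maximalRealSubfield L)) L (IsCMField.complexConj L) 2).Adelic => (1 : ℂ)) ((σ : ℝ) : ℂ)) g‖ ≤ C * (((⨆ γ : (quasiSplit (↥(maximalRealSubfield L)) L (IsCMField.complexConj L) 2).arithmeticSubgroup, borelHeight ((γ : (quasiSplit (↥(maximalRealSubfield L)) L (IsCMField.complexConj L) 2).Adelic) * g)) : ℝ≥0) : ℝ) ^ A)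
    (μ : Measure (quasiSplit (↥(maximalRealSubfield L)) L (IsCMField.complexConj L) 2).automorphicQuotient) {φ : (quasiSplit (↥(maximalRealSubfield L)) L (IsCMField.complexConj L) 2).automorphicQuotient → ℂ} (hdec : Integrable (fun x => (((supHeight (↥(maximalRealSubfield L)) L (IsCMField.complexConj L) 2 (x)) : ℝ≥0) : ℝ) ^ A * ‖φ x‖) μ)
    {Λ : (quasiSplit (↥(maximalRealSubfield L)) L (IsCMField.complexConj L) 2).Adelic → ℂ} (hΛq : (quasiSplit (↥(maximalRealSubfield L)) L (IsCMField.complexConj L) 2).quotFun Λ = φ) :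
    ∫⁻ x, (∑' q : Quotient (QuotientGroup.rightRel (arithmeticBorel (↥(maximalRealSubfield L)) L (IsCMField.complexConj L) 2)), ‖(flatSectionU (fun _ : (quasiSplit (↥(maximalRealSubfield L)) L (IsCMField.complexConj L) 2).Adelic => (1 : ℂ)) ((σ : ℝ) : ℂ)) (((q.out : (quasiSplit (↥(maximalRealSubfield L)) L (IsCMField.complexConj L) 2).arithmeticSubgroup) : (quasiSplit (↥(maximalRealSubfield L)) L (IsCMField.complexConj L) 2).Adelic) * ((Quotient.out (x) : (quasiSplit (↥(maximalRealSubfield L)) L (IsCMField.complexConj L) 2).Adelic))⁻¹)‖ₑ) * ‖Λ ((Quotient.out (x) : (quasiSplit (↥(maximalRealSubfield L)) L (IsCMField.complexConj L) 2).Adelic))⁻¹‖ₑ ∂μ < ∞ := by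
  have hσ0 : 0 < σ - 1 := sub_pos.2 hσ
  have hpt : ∀ x : (quasiSplit (↥(maximalRealSubfield L)) L (IsCMField.complexConj L) 2).automorphicQuotient, (∑' q : Quotient (QuotientGroup.rightRel (arithmeticBorel (↥(maximalRealSubfield L)) L (IsCMField.complexConj L) 2)), ‖(flatSectionU (fun _ : (quasiSplit (↥(maximalRealSubfield L)) L (IsCMField.complexConj L) 2).Adelic => (1 : ℂ)) ((σ : ℝ) : ℂ)) (((q.out : (quasiSplit (↥(maximalRealSubfield L)) L (IsCMField.complexConj L) 2).arithmeticSubgroup) : (quasiSplit (↥(maximalRealSubfield L)) L (IsCMField.complexConj L) 2).Adelic) * ((Quotient.out (x) : (quasiSplit (↥(maximalRealSubfield L)) L (IsCMField.complexConj L) 2).Adelic))⁻¹)‖ₑ) * ‖Λ ((Quotient.out (x) : (quasiSplit (↥(maximalRealSubfield L)) L (IsCMField.complexConj L) 2).Adelic))⁻¹‖ₑ ≤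
      ‖C / (σ - 1) * ((((supHeight (↥(maximalRealSubfield L)) L (IsCMField.complexConj L) 2 (x)) : ℝ≥0) : ℝ) ^ A * ‖φ x‖)‖ₑ := by
    intro x
    have hΛx : Λ ((Quotient.out (x) : (quasiSplit (↥(maximalRealSubfield L)) L (IsCMField.complexConj L) 2).Adelic))⁻¹ = φ x := congrFun hΛq x
    have hS : (∑' q : Quotient (MulAction.orbitRel ↥(borelU ((IsCMField.complexConj L : L ≃ₐ[↥(maximalRealSubfield L)] L) : L →+* L) ((StdForm.antidiagonal 2).over L)) ↥(unitaryGroupOfForm ((IsCMField.complexConj L : L ≃ₐ[↥(maximalRealSubfield L)] L) : L →+* L) ((StdForm.antidiagonal 2).over L))), ((borelHeight (((quasiSplit (↥(maximalRealSubfield L)) L (IsCMField.complexConj L) 2).toAdelic (Quotient.out q : ↥(unitaryGroupOfForm ((IsCMField.complexConj L : L ≃ₐ[↥(maximalRealSubfield L)] L) : L →+* L) ((StdForm.antidiagonal 2).over L)))) * (((Quotient.out (x) : (quasiSplit (↥(maximalRealSubfield L)) L (IsCMField.complexConj L) 2).Adelic))⁻¹)) : ℝ)) ^ σ) ≤ C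 / (σ - 1) * (((supHeight (↥(maximalRealSubfield L)) L (IsCMField.complexConj L) 2 (x)) : ℝ≥0) : ℝ) ^ A := by
      have h := hmaj ((Quotient.out (x) : (quasiSplit (↥(maximalRealSubfield L)) L (IsCMField.complexConj L) 2).Adelic))⁻¹
      rw [norm_eisensteinSeriesU_flatSectionU_const_ofReal, norm_one, one_mul, ← supHeight_eq_ciSup_out_inv] at h
      rw [div_mul_eq_mul_div, le_div_iff₀ hσ0, mul_comm]
      exact h
    rw [tsum_enorm_flatSectionU_one_eq_ofReal L hσ, hΛx, Real.enorm_eq_ofReal (by positivity), ← mul_assoc, ENNReal.ofReal_mul (by positivity), ofReal_norm]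
    exact mul_le_mul' (ENNReal.ofReal_le_ofReal hS) le_rfl
  calc ∫⁻ x, (∑' q : Quotient (QuotientGroup.rightRel (arithmeticBorel (↥(maximalRealSubfield L)) L (IsCMField.complexConj L) 2)), ‖(flatSectionU (fun _ : (quasiSplit (↥(maximalRealSubfield L)) L (IsCMField.complexConj L) 2).Adelic => (1 : ℂ)) ((σ : ℝ) : ℂ)) (((q.out : (quasiSplit (↥(maximalRealSubfield L)) L (IsCMField.complexConj L) 2).arithmeticSubgroup) : (quasiSplit (↥(maximalRealSubfield L)) L (IsCMField.complexConj L) 2).Adelic) * ((Quotient.out (x) : (quasiSplit (↥(maximalRealSubfield L)) L (IsCMField.complexConj L) 2).Adelic))⁻¹)‖ₑ) * ‖Λ ((Quotient.out (x) : (quasiSplit (↥(maximalRealSubfield L)) L (IsCMField.complexConj L) 2).Adelic))⁻¹‖ₑ ∂μ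
      ≤ ∫⁻ x, ‖C / (σ - 1) * ((((supHeight (↥(maximalRealSubfield L)) L (IsCMField.complexConj L) 2 (x)) : ℝ≥0) : ℝ) ^ A * ‖φ x‖)‖ₑ ∂μ := lintegral_mono hpt
    _ < ∞ := (hdec.const_mul (C / (σ - 1))).hasFiniteIntegral

variable [MeasurableSpace (quasiSplit (↥(maximalRealSubfield L)) L (IsCMField.complexConj L) 2).Adelic] [BorelSpace (quasiSplit (↥(maximalRealSubfield L)) L (IsCMField.complexConj L) 2).Adelic]

/-! ## §4 Step (1): «E ⊥ cusp» for `σ ∈ (1, 1 + η]`, the `L¹` letter discharged by the decay letter -/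

/-- **STEP (1) — `∫_X E(H^σ)(x̃⁻¹)·conj φ(x) dμ = 0` AND ITS ABSOLUTE CONVERGENCE, for a cusp form with a decay letter.**  For the CM pair, `δ ∈ L⁻∖0`, a Haar measure `ν` of `N(𝔸)`, a
fundamental domain `𝓕` of `N(L⁺)` with compact closure, an automorphic `μ` on `X`, an inversion-invariant Haar `ν_G` on `G(𝔸)`, parabolic data `𝔓` with `𝔓.radical i = N(𝔸)`,
`φ ∈ cuspForms μ 𝔓`, `σ > 1` with a majorant `(σ−1)·‖E(H^σ)‖ ≤ C·w₁^A` (★ (R-b)) and the decay letter `Integrable (w₁^A·‖φ‖) μ`: the pairing integrand is `μ`-integrable and its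
integral vanishes (★ FILE A at `Λ = invQuot φ` ★ (β1); `hL1` by ★ FILE B §2 from §2's `hX`; `β` by ★ `exists_isCoveringWeight_arithmeticBorel`; `ν` inversion-invariant ★).
[cite: MoeglinWaldspurger1995, II.1.8] [cite: BernsteinLapid2019, §4 Claim 2] [cite: BorelJacquet1979, §4.4] -/
theorem integrable_and_integral_quotFun_eisensteinSeriesU_mul_conj_eq_zero_of_mem_cuspForms
    (ν : Measure ↥(adelicUnipotent (↥(maximalRealSubfield L)) L (IsCMField.complexConj L) 2)) [ν.IsHaarMeasure] {𝓕 : Set ↥(adelicUnipotent (↥(maximalRealSubfield L)) L (IsCMField.complexConj L) 2)} (h𝓕N : IsFundamentalDomain ↥(rationalUnipotent (↥(maximalRealSubfield L)) L (IsCMField.complexConj L) 2) 𝓕 ν) (h𝓕c : IsCompact (closure 𝓕))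
    (μ : Measure (quasiSplit (↥(maximalRealSubfield L)) L (IsCMField.complexConj L) 2).automorphicQuotient) [(quasiSplit (↥(maximalRealSubfield L)) L (IsCMField.complexConj L) 2).IsAutomorphicMeasure μ] (νG : Measure (quasiSplit (↥(maximalRealSubfield L)) L (IsCMField.complexConj L) 2).Adelic) [νG.IsHaarMeasure] [νG.IsInvInvariant]
    (𝔓 : (quasiSplit (↥(maximalRealSubfield L)) L (IsCMField.complexConj L) 2).ParabolicUnipotentData) (i : 𝔓.ι) (h𝔓 : 𝔓.radical i = adelicUnipotent (↥(maximalRealSubfield L)) L (IsCMField.complexConj L) 2)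
    {φ : (quasiSplit (↥(maximalRealSubfield L)) L (IsCMField.complexConj L) 2).automorphicQuotient → ℂ} (hφ : φ ∈ (quasiSplit (↥(maximalRealSubfield L)) L (IsCMField.complexConj L) 2).cuspForms μ 𝔓) {σ C A : ℝ} (hσ : 1 < σ) (hC : 0 ≤ C)
    (hmaj : ∀ g : (quasiSplit (↥(maximalRealSubfield L)) L (IsCMField.complexConj L) 2).Adelic, (σ - 1) * ‖eisensteinSeriesU (flatSectionU (fun _ : (quasiSplit (↥(maximalRealSubfield L)) L (IsCMField.complexConj L) 2).Adelic => (1 : ℂ)) ((σ : ℝ) : ℂ)) g‖ ≤ C * (((⨆ γ : (quasiSplit (↥(maximalRealSubfield L)) L (IsCMField.complexConj L) 2).arithmeticSubgroup, borelHeight ((γ : (quasiSplit (↥(maximalRealSubfield L)) L (IsCMField.complexConj L) 2).Adelic) * g)) : ℝ≥0) : ℝ) ^ A)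
    (hdec : Integrable (fun x => (((supHeight (↥(maximalRealSubfield L)) L (IsCMField.complexConj L) 2 (x)) : ℝ≥0) : ℝ) ^ A * ‖φ x‖) μ) :
    Integrable (fun x : (quasiSplit (↥(maximalRealSubfield L)) L (IsCMField.complexConj L) 2).automorphicQuotient => (quasiSplit (↥(maximalRealSubfield L)) L (IsCMField.complexConj L) 2).quotFun (eisensteinSeriesU (flatSectionU (fun _ : (quasiSplit (↥(maximalRealSubfield L)) L (IsCMField.complexConj L) 2).Adelic => (1 : ℂ)) ((σ : ℝ) : ℂ))) x * conj (φ x)) μ ∧ ∫ x, (quasiSplit (↥(maximalRealSubfield L)) L (IsCMField.complexConj L) 2).quotFun (eisensteinSeriesU (flatSectionU (fun _ : (quasiSplit (↥(maximalRealSubfield L)) L (IsCMField.complexConj L) 2).Adelic => (1 : ℂ)) ((σ : ℝ) : ℂ))) x * conj (φ x) ∂μ = 0 := by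
  haveI := t2Space_adeleRing_of_numberField L
  haveI := locallyCompactSpace_adeleRing' L
  haveI : T2Space (quasiSplit (↥(maximalRealSubfield L)) L (IsCMField.complexConj L) 2).Adelic := inferInstanceAs (T2Space (adelic (↥(maximalRealSubfield L)) L (IsCMField.complexConj L) 2 ((StdForm.antidiagonal 2).over L)))
  haveI : ν.IsInvInvariant := isInvInvariant_of_isHaarMeasure_two (F := (↥(maximalRealSubfield L))) (E := L) (c := (IsCMField.complexConj L)) ν
  have hc : (IsCMField.complexConj L) * (IsCMField.complexConj L) = 1 := AlgEquiv.ext fun x => IsCMField.complexConj_apply_apply L x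
  have hc1 : (IsCMField.complexConj L) ≠ 1 := IsCMField.complexConj_ne_one L
  have h𝓕₀ : ν 𝓕 ≠ 0 := measure_ne_zero_of_isFundamentalDomain_rationalUnipotent ν h𝓕N
  have h𝓕top : ν 𝓕 ≠ ∞ := ((measure_mono subset_closure).trans_lt h𝓕c.measure_lt_top).ne
  obtain ⟨β, hβ⟩ := exists_isCoveringWeight_arithmeticBorel (F := (↥(maximalRealSubfield L))) (E := L) (c := (IsCMField.complexConj L)) (N := 2)
  -- the section `f_σ = H^σ`: Borel, left-`N(𝔸)`- and left-`B(F)`-invariant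
  have hfm : Measurable (flatSectionU (fun _ : (quasiSplit (↥(maximalRealSubfield L)) L (IsCMField.complexConj L) 2).Adelic => (1 : ℂ)) ((σ : ℝ) : ℂ)) := measurable_flatSectionU measurable_const _
  have hfN : ∀ (u : ↥(adelicUnipotent (↥(maximalRealSubfield L)) L (IsCMField.complexConj L) 2)) (y : (quasiSplit (↥(maximalRealSubfield L)) L (IsCMField.complexConj L) 2).Adelic), (flatSectionU (fun _ : (quasiSplit (↥(maximalRealSubfield L)) L (IsCMField.complexConj L) 2).Adelic => (1 : ℂ)) ((σ : ℝ) : ℂ)) ((u : (quasiSplit (↥(maximalRealSubfield L)) L (IsCMField.complexConj L) 2).Adelic) * y) = (flatSectionU (fun _ : (quasiSplit (↥(maximalRealSubfield L)) L (IsCMField.complexConj L) 2).Adelic => (1 : ℂ)) ((σ : ℝ) : ℂ)) y := fun u y => by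
    rw [flatSectionU_apply, flatSectionU_apply, borelHeight_unipotent_mul u.2 y]
  have hfB : ∀ b ∈ arithmeticBorel (↥(maximalRealSubfield L)) L (IsCMField.complexConj L) 2, ∀ x : (quasiSplit (↥(maximalRealSubfield L)) L (IsCMField.complexConj L) 2).Adelic, (flatSectionU (fun _ : (quasiSplit (↥(maximalRealSubfield L)) L (IsCMField.complexConj L) 2).Adelic => (1 : ℂ)) ((σ : ℝ) : ℂ)) ((b : (quasiSplit (↥(maximalRealSubfield L)) L (IsCMField.complexConj L) 2).Adelic) * x) = (flatSectionU (fun _ : (quasiSplit (↥(maximalRealSubfield L)) L (IsCMField.complexConj L) 2).Adelic => (1 : ℂ)) ((σ : ℝ) : ℂ)) x := fun b hb x => by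
    rw [flatSectionU_apply, flatSectionU_apply, K2E1TruncatedEisensteinExplicit.borelHeight_arithmeticBorel_mul hb]
  -- the lift `Λ = invQuot φ` (★ (β1))
  obtain ⟨hΛm, hΛinv, hΛq, hΛB⟩ := invQuot_package_of_mem_cuspForms 𝔓 i h𝔓 ν h𝓕N hφ
  have hΛG : ∀ (γ : (quasiSplit (↥(maximalRealSubfield L)) L (IsCMField.complexConj L) 2).arithmeticSubgroup) (x : (quasiSplit (↥(maximalRealSubfield L)) L (IsCMField.complexConj L) 2).Adelic), invQuot (quasiSplit (↥(maximalRealSubfield L)) L (IsCMField.complexConj L) 2) φ ((γ : (quasiSplit (↥(maximalRealSubfield L)) L (IsCMField.complexConj L) 2).Adelic) * x) = invQuot (quasiSplit (↥(maximalRealSubfield L)) L (IsCMField.complexConj L) 2) φ x :=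
    fun γ x => hΛinv _ ((quasiSplit (↥(maximalRealSubfield L)) L (IsCMField.complexConj L) 2).arithmeticSubgroup_le_quotientSubgroup γ.2) x
  -- the `L¹` letter (★ FILE B §2 from §2) and ★ FILE A
  have hX := lintegral_tsum_enorm_mul_lt_top_of_majorant L hσ hC hmaj μ hdec hΛq
  have hL1 := lintegral_weight_enorm_mul_lt_top_of_lintegral_quotient_lt_top μ νG hβ hfm hΛm hfB hΛG hX
  obtain ⟨-, -, hint, -⟩ := integrable_and_integral_quotFun_eisensteinSeriesU_mul_conj_eq_two hc hc1 μ νG ν h𝓕N h𝓕₀ h𝓕top hβ hfm hΛm hfN hfB hΛG hL1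
  have h0 := integral_quotFun_eisensteinSeriesU_mul_conj_eq_zero_two hc hc1 μ νG ν h𝓕N h𝓕₀ h𝓕top hβ hfm hΛm hfN hfB hΛG hL1 (ae_of_all _ hΛB)
  rw [hΛq] at hint h0
  exact ⟨hint, h0⟩

/-! ## §5 Step (2): dominated convergence along `σ → 1⁺` — the head -/

/-- **CUSP FORMS WITH A DECAY LETTER HAVE MEAN ZERO ON `U(1,1)(L⁺)∖U(1,1)(𝔸_{L⁺})`.**  For the CM pair `(L⁺, L)`, `δ ∈ L⁻ ∖ 0`, a Haar measure `ν` of `N(𝔸)` and a fundamental domain `𝓕` of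
`N(L⁺)` with compact closure (the capstone's binders), an automorphic measure `μ` on `X = G(𝔸) ⧸ G(L⁺)`, an inversion-invariant Haar measure `ν_G` on `G(𝔸)` (★ FILE A's instance
letter), parabolic data `𝔓` whose radical at `i` is `N(𝔸)`, a cusp form `φ ∈ cuspForms μ 𝔓`, and the decay letter `Integrable (w₁^A·‖φ‖) μ` for some `A > 1`:  **`∫_X φ dμ = 0`.**
Proof: §4 gives `∫_X (σ−1)E(H^σ)(x̃⁻¹)·conj φ dμ = 0` for `σ ∈ (1, 1+η]` (★ (R-b)'s `η, C`); the integrands are dominated by `C·w₁^A·‖φ‖` (★ (R-b)) and tend to `(1·r)·conj φ` pointwise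
(§3 ∘ ★ capstone); dominated convergence on `𝓝[>] 1` gives `(1·r)·conj(∫ φ) = 0`, and `r ≠ 0`.  This is (ρ2)'s letter `hmean` for decaying cusp forms; the extension to all of
`cuspForms` is (R-d) (density of smoothed cusp forms, the K1 estimate). [cite: MoeglinWaldspurger1995, I.2.18 and IV.1.9–IV.1.11] [cite: Langlands1976, §7] [cite: Garrett2018, §1.11–§1.12] -/
theorem integral_eq_zero_of_mem_cuspForms_of_decay_cm_two {δ : L} (hcδ : IsCMField.complexConj L δ = -δ) (hδ : δ ≠ 0)
    (ν : Measure ↥(adelicUnipotent (↥(maximalRealSubfield L)) L (IsCMField.complexConj L) 2)) [ν.IsHaarMeasure] {𝓕 : Set ↥(adelicUnipotent (↥(maximalRealSubfield L)) L (IsCMField.complexConj L) 2)} (h𝓕N : IsFundamentalDomain ↥(rationalUnipotent (↥(maximalRealSubfield L)) L (IsCMField.complexConj L) 2) 𝓕 ν) (h𝓕c : IsCompact (closure 𝓕))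
    (μ : Measure (quasiSplit (↥(maximalRealSubfield L)) L (IsCMField.complexConj L) 2).automorphicQuotient) [(quasiSplit (↥(maximalRealSubfield L)) L (IsCMField.complexConj L) 2).IsAutomorphicMeasure μ] (νG : Measure (quasiSplit (↥(maximalRealSubfield L)) L (IsCMField.complexConj L) 2).Adelic) [νG.IsHaarMeasure] [νG.IsInvInvariant]
    (𝔓 : (quasiSplit (↥(maximalRealSubfield L)) L (IsCMField.complexConj L) 2).ParabolicUnipotentData) (i : 𝔓.ι) (h𝔓 : 𝔓.radical i = adelicUnipotent (↥(maximalRealSubfield L)) L (IsCMField.complexConj L) 2)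
    {φ : (quasiSplit (↥(maximalRealSubfield L)) L (IsCMField.complexConj L) 2).automorphicQuotient → ℂ} (hφ : φ ∈ (quasiSplit (↥(maximalRealSubfield L)) L (IsCMField.complexConj L) 2).cuspForms μ 𝔓) {A : ℝ} (hA : 1 < A)
    (hdec : Integrable (fun x => (((supHeight (↥(maximalRealSubfield L)) L (IsCMField.complexConj L) 2 (x)) : ℝ≥0) : ℝ) ^ A * ‖φ x‖) μ) :
    ∫ x, φ x ∂μ = 0 := by
  have hij : (((0 : Fin 2) : ℕ)) + 1 = ((1 : Fin 2) : ℕ) := rfl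
  have hN : 2 = 2 * ((0 : Fin 2) : ℕ) + 2 := rfl
  -- a Borel structure on `𝔸_{L⁺}` (the capstone's section instances; its conclusion does not depend on the choice)
  letI : MeasurableSpace (AdeleRing (𝓞 (↥(maximalRealSubfield L))) (↥(maximalRealSubfield L))) := borel _
  haveI : BorelSpace (AdeleRing (𝓞 (↥(maximalRealSubfield L))) (↥(maximalRealSubfield L))) := ⟨rfl⟩
  -- ★ (R-b): the uniform majorant; ★ capstone: the residue `r ≠ 0` and the pointwise limits
  obtain ⟨η, hη, C, hC, hmaj⟩ := residue_uniform_majorant_cm_two L hcδ hδ ν h𝓕N h𝓕c 1 hA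
  obtain ⟨r, hr, hcont⟩ := sphericalEisenstein_continuation_cm_two L hij hN hcδ hδ ν h𝓕N h𝓕c 1
  -- step (1) for every `σ ∈ (1, 1 + η]`
  have h1 : ∀ σ : ℝ, 1 < σ → σ ≤ 1 + η →
      Integrable (fun x : (quasiSplit (↥(maximalRealSubfield L)) L (IsCMField.complexConj L) 2).automorphicQuotient => (quasiSplit (↥(maximalRealSubfield L)) L (IsCMField.complexConj L) 2).quotFun (eisensteinSeriesU (flatSectionU (fun _ : (quasiSplit (↥(maximalRealSubfield L)) L (IsCMField.complexConj L) 2).Adelic => (1 : ℂ)) ((σ : ℝ) : ℂ))) x * conj (φ x)) μ ∧ ∫ x, (quasiSplit (↥(maximalRealSubfield L)) L (IsCMField.complexConj L) 2).quotFun (eisensteinSeriesU (flatSectionU (fun _ : (quasiSplit (↥(maximalRealSubfield L)) L (IsCMField.complexConj L) 2).Adelic => (1 : ℂ)) ((σ : ℝ) : ℂ))) x * conj (φ x) ∂μ = 0 := fun σ hσ hση =>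
    integrable_and_integral_quotFun_eisensteinSeriesU_mul_conj_eq_zero_of_mem_cuspForms L ν h𝓕N h𝓕c μ νG 𝔓 i h𝔓 hφ hσ hC (hmaj σ hσ hση) hdec
  have hwin : ∀ᶠ σ : ℝ in 𝓝[>] (1 : ℝ), σ ∈ Ioc (1 : ℝ) (1 + η) := Ioc_mem_nhdsGT (by linarith)
  -- dominated convergence for `F_σ(x) = (σ−1)·E(H^σ)(x̃⁻¹)·conj φ(x)` along `𝓝[>] 1`
  have hT : Tendsto (fun σ : ℝ => ∫ x, (((σ - 1 : ℝ)) : ℂ) * ((quasiSplit (↥(maximalRealSubfield L)) L (IsCMField.complexConj L) 2).quotFun (eisensteinSeriesU (flatSectionU (fun _ : (quasiSplit (↥(maximalRealSubfield L)) L (IsCMField.complexConj L) 2).Adelic => (1 : ℂ)) ((σ : ℝ) : ℂ))) x * conj (φ x)) ∂μ) (𝓝[>] (1 : ℝ))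
      (𝓝 (∫ x, (1 * r) * conj (φ x) ∂μ)) := by
    refine tendsto_integral_filter_of_dominated_convergence (fun x => C * ((((supHeight (↥(maximalRealSubfield L)) L (IsCMField.complexConj L) 2 (x)) : ℝ≥0) : ℝ) ^ A * ‖φ x‖)) ?_ ?_ (hdec.const_mul C) (ae_of_all _ fun x => ?_)
    · filter_upwards [hwin] with σ hσ
      exact ((h1 σ hσ.1 hσ.2).1.const_mul _).aestronglyMeasurable
    · filter_upwards [hwin] with σ hσ
      refine ae_of_all _ fun x => ?_
      have hm := hmaj σ hσ.1 hσ.2 ((Quotient.out (x) : (quasiSplit (↥(maximalRealSubfield L)) L (IsCMField.complexConj L) 2).Adelic))⁻¹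
      rw [← supHeight_eq_ciSup_out_inv] at hm
      rw [norm_mul, norm_mul, Complex.norm_real, Real.norm_of_nonneg (sub_nonneg.2 hσ.1.le), Complex.norm_conj]
      calc (σ - 1) * (‖(quasiSplit (↥(maximalRealSubfield L)) L (IsCMField.complexConj L) 2).quotFun (eisensteinSeriesU (flatSectionU (fun _ : (quasiSplit (↥(maximalRealSubfield L)) L (IsCMField.complexConj L) 2).Adelic => (1 : ℂ)) ((σ : ℝ) : ℂ))) x‖ * ‖φ x‖) = (σ - 1) * ‖eisensteinSeriesU (flatSectionU (fun _ : (quasiSplit (↥(maximalRealSubfield L)) L (IsCMField.complexConj L) 2).Adelic => (1 : ℂ)) ((σ : ℝ) : ℂ)) ((Quotient.out (x) : (quasiSplit (↥(maximalRealSubfield L)) L (IsCMField.complexConj L) 2).Adelic))⁻¹‖ * ‖φ x‖ := by rw [mul_assoc]; rfl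
        _ ≤ C * (((supHeight (↥(maximalRealSubfield L)) L (IsCMField.complexConj L) 2 (x)) : ℝ≥0) : ℝ) ^ A * ‖φ x‖ := mul_le_mul_of_nonneg_right hm (norm_nonneg _)
        _ = C * ((((supHeight (↥(maximalRealSubfield L)) L (IsCMField.complexConj L) 2 (x)) : ℝ≥0) : ℝ) ^ A * ‖φ x‖) := mul_assoc _ _ _
    · -- the pointwise limit at `x = [g]`, `g̃⁻¹ = (out x)⁻¹`
      obtain ⟨Ec, -, -, hb, hlim⟩ := hcont ((Quotient.out (x) : (quasiSplit (↥(maximalRealSubfield L)) L (IsCMField.complexConj L) 2).Adelic))⁻¹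
      have hT1 := (tendsto_sub_one_mul_eisensteinSeriesU_nhdsGT_one L hb hlim).mul_const (conj (φ x))
      refine hT1.congr' (Eventually.of_forall fun σ => ?_)
      show (((σ : ℝ) : ℂ) - 1) * eisensteinSeriesU (flatSectionU (fun _ : (quasiSplit (↥(maximalRealSubfield L)) L (IsCMField.complexConj L) 2).Adelic => (1 : ℂ)) ((σ : ℝ) : ℂ)) ((Quotient.out (x) : (quasiSplit (↥(maximalRealSubfield L)) L (IsCMField.complexConj L) 2).Adelic))⁻¹ * conj (φ x) = (((σ - 1 : ℝ)) : ℂ) * ((quasiSplit (↥(maximalRealSubfield L)) L (IsCMField.complexConj L) 2).quotFun (eisensteinSeriesU (flatSectionU (fun _ : (quasiSplit (↥(maximalRealSubfield L)) L (IsCMField.complexConj L) 2).Adelic => (1 : ℂ)) ((σ : ℝ) : ℂ))) x * conj (φ x))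
      push_cast
      rw [mul_assoc]
      rfl
  -- the integrals vanish on the window, hence so does the limit
  have hzero : (fun σ : ℝ => ∫ x, (((σ - 1 : ℝ)) : ℂ) * ((quasiSplit (↥(maximalRealSubfield L)) L (IsCMField.complexConj L) 2).quotFun (eisensteinSeriesU (flatSectionU (fun _ : (quasiSplit (↥(maximalRealSubfield L)) L (IsCMField.complexConj L) 2).Adelic => (1 : ℂ)) ((σ : ℝ) : ℂ))) x * conj (φ x)) ∂μ) =ᶠ[𝓝[>] (1 : ℝ)] fun _ => (0 : ℂ) := by
    filter_upwards [hwin] with σ hσ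
    rw [integral_const_mul, (h1 σ hσ.1 hσ.2).2, mul_zero]
  have hI : ∫ x, (1 * r) * conj (φ x) ∂μ = 0 := (tendsto_const_nhds_iff.1 (hT.congr' hzero)).symm
  rw [integral_const_mul, integral_conj, mul_eq_zero] at hI
  have hconj : conj (∫ x, φ x ∂μ) = 0 := hI.resolve_left (by rw [one_mul]; exact hr)
  exact (map_eq_zero_iff (starRingEnd ℂ) (RingHom.injective _)).1 hconj

/-! ## §6 (ED. 2, append-only) The same two theorems under the WEAKER hypotheses «`φ` continuous with vanishing constant term at the radical `i`» -/

/-- **STEP (1) UNDER THE MINIMAL HYPOTHESES** — as §4, but asking of `φ` only continuity and the cusp condition AT THE BOREL RADICAL `i` (`ConstantTermVanishes 𝔓 φ i`), not membership in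
`cuspForms μ 𝔓` (no `L²` clause, no condition at other indices): the lift `Λ = invQuot φ` is Borel (★ `measurable_invQuot`), left-`A_G G(F)`-invariant (★ `invQuot_mul_left`), descends to `φ`
(★ `quotFun_invQuot`) and has `Λ_B ≡ 0` (★ `borelConstantTerm_invQuot_eq_zero_of_constantTermVanishes`).  This is the shape (R-d) consumes for SMOOTHED cusp forms `S_η S_Θ φ`, whose cusp
condition is checked at the Borel radical only. [cite: MoeglinWaldspurger1995, II.1.8] [cite: BorelJacquet1979, §4.4] -/
theorem integrable_and_integral_quotFun_eisensteinSeriesU_mul_conj_eq_zero_of_constantTermVanishes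
    (ν : Measure ↥(adelicUnipotent (↥(maximalRealSubfield L)) L (IsCMField.complexConj L) 2)) [ν.IsHaarMeasure] {𝓕 : Set ↥(adelicUnipotent (↥(maximalRealSubfield L)) L (IsCMField.complexConj L) 2)} (h𝓕N : IsFundamentalDomain ↥(rationalUnipotent (↥(maximalRealSubfield L)) L (IsCMField.complexConj L) 2) 𝓕 ν) (h𝓕c : IsCompact (closure 𝓕))
    (μ : Measure (quasiSplit (↥(maximalRealSubfield L)) L (IsCMField.complexConj L) 2).automorphicQuotient) [(quasiSplit (↥(maximalRealSubfield L)) L (IsCMField.complexConj L) 2).IsAutomorphicMeasure μ] (νG : Measure (quasiSplit (↥(maximalRealSubfield L)) L (IsCMField.complexConj L) 2).Adelic) [νG.IsHaarMeasure] [νG.IsInvInvariant]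
    (𝔓 : (quasiSplit (↥(maximalRealSubfield L)) L (IsCMField.complexConj L) 2).ParabolicUnipotentData) (i : 𝔓.ι) (h𝔓 : 𝔓.radical i = adelicUnipotent (↥(maximalRealSubfield L)) L (IsCMField.complexConj L) 2)
    {φ : (quasiSplit (↥(maximalRealSubfield L)) L (IsCMField.complexConj L) 2).automorphicQuotient → ℂ} (hφc : Continuous φ) (hφi : ConstantTermVanishes 𝔓 φ i) {σ C A : ℝ} (hσ : 1 < σ) (hC : 0 ≤ C)
    (hmaj : ∀ g : (quasiSplit (↥(maximalRealSubfield L)) L (IsCMField.complexConj L) 2).Adelic, (σ - 1) * ‖eisensteinSeriesU (flatSectionU (fun _ : (quasiSplit (↥(maximalRealSubfield L)) L (IsCMField.complexConj L) 2).Adelic => (1 : ℂ)) ((σ : ℝ) : ℂ)) g‖ ≤ C * (((⨆ γ : (quasiSplit (↥(maximalRealSubfield L)) L (IsCMField.complexConj L) 2).arithmeticSubgroup, borelHeight ((γ : (quasiSplit (↥(maximalRealSubfield L)) L (IsCMField.complexConj L) 2).Adelic) * g)) : ℝ≥0) : ℝ) ^ A)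
    (hdec : Integrable (fun x => (((supHeight (↥(maximalRealSubfield L)) L (IsCMField.complexConj L) 2 (x)) : ℝ≥0) : ℝ) ^ A * ‖φ x‖) μ) :
    Integrable (fun x : (quasiSplit (↥(maximalRealSubfield L)) L (IsCMField.complexConj L) 2).automorphicQuotient => (quasiSplit (↥(maximalRealSubfield L)) L (IsCMField.complexConj L) 2).quotFun (eisensteinSeriesU (flatSectionU (fun _ : (quasiSplit (↥(maximalRealSubfield L)) L (IsCMField.complexConj L) 2).Adelic => (1 : ℂ)) ((σ : ℝ) : ℂ))) x * conj (φ x)) μ ∧ ∫ x, (quasiSplit (↥(maximalRealSubfield L)) L (IsCMField.complexConj L) 2).quotFun (eisensteinSeriesU (flatSectionU (fun _ : (quasiSplit (↥(maximalRealSubfield L)) L (IsCMField.complexConj L) 2).Adelic => (1 : ℂ)) ((σ : ℝ) : ℂ))) x * conj (φ x) ∂μ = 0 := by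
  haveI := t2Space_adeleRing_of_numberField L
  haveI := locallyCompactSpace_adeleRing' L
  haveI : T2Space (quasiSplit (↥(maximalRealSubfield L)) L (IsCMField.complexConj L) 2).Adelic := inferInstanceAs (T2Space (adelic (↥(maximalRealSubfield L)) L (IsCMField.complexConj L) 2 ((StdForm.antidiagonal 2).over L)))
  haveI : ν.IsInvInvariant := isInvInvariant_of_isHaarMeasure_two (F := (↥(maximalRealSubfield L))) (E := L) (c := (IsCMField.complexConj L)) ν
  have hc : (IsCMField.complexConj L) * (IsCMField.complexConj L) = 1 := AlgEquiv.ext fun x => IsCMField.complexConj_apply_apply L x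
  have hc1 : (IsCMField.complexConj L) ≠ 1 := IsCMField.complexConj_ne_one L
  have h𝓕₀ : ν 𝓕 ≠ 0 := measure_ne_zero_of_isFundamentalDomain_rationalUnipotent ν h𝓕N
  have h𝓕top : ν 𝓕 ≠ ∞ := ((measure_mono subset_closure).trans_lt h𝓕c.measure_lt_top).ne
  obtain ⟨β, hβ⟩ := exists_isCoveringWeight_arithmeticBorel (F := (↥(maximalRealSubfield L))) (E := L) (c := (IsCMField.complexConj L)) (N := 2)
  have hfm : Measurable (flatSectionU (fun _ : (quasiSplit (↥(maximalRealSubfield L)) L (IsCMField.complexConj L) 2).Adelic => (1 : ℂ)) ((σ : ℝ) : ℂ)) := measurable_flatSectionU measurable_const _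
  have hfN : ∀ (u : ↥(adelicUnipotent (↥(maximalRealSubfield L)) L (IsCMField.complexConj L) 2)) (y : (quasiSplit (↥(maximalRealSubfield L)) L (IsCMField.complexConj L) 2).Adelic), (flatSectionU (fun _ : (quasiSplit (↥(maximalRealSubfield L)) L (IsCMField.complexConj L) 2).Adelic => (1 : ℂ)) ((σ : ℝ) : ℂ)) ((u : (quasiSplit (↥(maximalRealSubfield L)) L (IsCMField.complexConj L) 2).Adelic) * y) = (flatSectionU (fun _ : (quasiSplit (↥(maximalRealSubfield L)) L (IsCMField.complexConj L) 2).Adelic => (1 : ℂ)) ((σ : ℝ) : ℂ)) y := fun u y => by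
    rw [flatSectionU_apply, flatSectionU_apply, borelHeight_unipotent_mul u.2 y]
  have hfB : ∀ b ∈ arithmeticBorel (↥(maximalRealSubfield L)) L (IsCMField.complexConj L) 2, ∀ x : (quasiSplit (↥(maximalRealSubfield L)) L (IsCMField.complexConj L) 2).Adelic, (flatSectionU (fun _ : (quasiSplit (↥(maximalRealSubfield L)) L (IsCMField.complexConj L) 2).Adelic => (1 : ℂ)) ((σ : ℝ) : ℂ)) ((b : (quasiSplit (↥(maximalRealSubfield L)) L (IsCMField.complexConj L) 2).Adelic) * x) = (flatSectionU (fun _ : (quasiSplit (↥(maximalRealSubfield L)) L (IsCMField.complexConj L) 2).Adelic => (1 : ℂ)) ((σ : ℝ) : ℂ)) x := fun b hb x => by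
    rw [flatSectionU_apply, flatSectionU_apply, K2E1TruncatedEisensteinExplicit.borelHeight_arithmeticBorel_mul hb]
  -- the lift `Λ = invQuot φ`, from continuity and the cusp condition at `i` alone
  have hΛm : Measurable (invQuot (quasiSplit (↥(maximalRealSubfield L)) L (IsCMField.complexConj L) 2) φ) := K2E1CuspConditionDictionaryU.measurable_invQuot _ hφc
  have hΛq : (quasiSplit (↥(maximalRealSubfield L)) L (IsCMField.complexConj L) 2).quotFun (invQuot (quasiSplit (↥(maximalRealSubfield L)) L (IsCMField.complexConj L) 2) φ) = φ := K2E1CuspConditionDictionaryU.quotFun_invQuot _ φ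
  have hΛB : ∀ g : (quasiSplit (↥(maximalRealSubfield L)) L (IsCMField.complexConj L) 2).Adelic, borelConstantTerm ν 𝓕 (invQuot (quasiSplit (↥(maximalRealSubfield L)) L (IsCMField.complexConj L) 2) φ) g = 0 :=
    K2E1CuspConditionDictionaryU.borelConstantTerm_invQuot_eq_zero_of_constantTermVanishes 𝔓 i h𝔓 ν h𝓕N hφi
  have hΛG : ∀ (γ : (quasiSplit (↥(maximalRealSubfield L)) L (IsCMField.complexConj L) 2).arithmeticSubgroup) (x : (quasiSplit (↥(maximalRealSubfield L)) L (IsCMField.complexConj L) 2).Adelic), invQuot (quasiSplit (↥(maximalRealSubfield L)) L (IsCMField.complexConj L) 2) φ ((γ : (quasiSplit (↥(maximalRealSubfield L)) L (IsCMField.complexConj L) 2).Adelic) * x) = invQuot (quasiSplit (↥(maximalRealSubfield L)) L (IsCMField.complexConj L) 2) φ x :=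
    fun γ x => invQuot_mul_left _ φ ((quasiSplit (↥(maximalRealSubfield L)) L (IsCMField.complexConj L) 2).arithmeticSubgroup_le_quotientSubgroup γ.2) x
  have hX := lintegral_tsum_enorm_mul_lt_top_of_majorant L hσ hC hmaj μ hdec hΛq
  have hL1 := lintegral_weight_enorm_mul_lt_top_of_lintegral_quotient_lt_top μ νG hβ hfm hΛm hfB hΛG hX
  obtain ⟨-, -, hint, -⟩ := integrable_and_integral_quotFun_eisensteinSeriesU_mul_conj_eq_two hc hc1 μ νG ν h𝓕N h𝓕₀ h𝓕top hβ hfm hΛm hfN hfB hΛG hL1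
  have h0 := integral_quotFun_eisensteinSeriesU_mul_conj_eq_zero_two hc hc1 μ νG ν h𝓕N h𝓕₀ h𝓕top hβ hfm hΛm hfN hfB hΛG hL1 (ae_of_all _ hΛB)
  rw [hΛq] at hint h0
  exact ⟨hint, h0⟩

/-- **THE HEAD UNDER THE MINIMAL HYPOTHESES — `∫_X φ dμ = 0` for `φ` CONTINUOUS WITH VANISHING CONSTANT TERM AT THE BOREL RADICAL and the decay letter `Integrable (w₁^A·‖φ‖) μ`, `A > 1`**
(as §5, through §6's step (1)): no `L²` clause and no condition at the other indices of `𝔓` are used — the form (R-d) applies to smoothed cusp forms.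
[cite: MoeglinWaldspurger1995, I.2.18 and IV.1.9–IV.1.11] [cite: Langlands1976, §7] [cite: Garrett2018, §1.11–§1.12] -/
theorem integral_eq_zero_of_constantTermVanishes_of_decay_cm_two {δ : L} (hcδ : IsCMField.complexConj L δ = -δ) (hδ : δ ≠ 0)
    (ν : Measure ↥(adelicUnipotent (↥(maximalRealSubfield L)) L (IsCMField.complexConj L) 2)) [ν.IsHaarMeasure] {𝓕 : Set ↥(adelicUnipotent (↥(maximalRealSubfield L)) L (IsCMField.complexConj L) 2)} (h𝓕N : IsFundamentalDomain ↥(rationalUnipotent (↥(maximalRealSubfield L)) L (IsCMField.complexConj L) 2) 𝓕 ν) (h𝓕c : IsCompact (closure 𝓕))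
    (μ : Measure (quasiSplit (↥(maximalRealSubfield L)) L (IsCMField.complexConj L) 2).automorphicQuotient) [(quasiSplit (↥(maximalRealSubfield L)) L (IsCMField.complexConj L) 2).IsAutomorphicMeasure μ] (νG : Measure (quasiSplit (↥(maximalRealSubfield L)) L (IsCMField.complexConj L) 2).Adelic) [νG.IsHaarMeasure] [νG.IsInvInvariant]
    (𝔓 : (quasiSplit (↥(maximalRealSubfield L)) L (IsCMField.complexConj L) 2).ParabolicUnipotentData) (i : 𝔓.ι) (h𝔓 : 𝔓.radical i = adelicUnipotent (↥(maximalRealSubfield L)) L (IsCMField.complexConj L) 2)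
    {φ : (quasiSplit (↥(maximalRealSubfield L)) L (IsCMField.complexConj L) 2).automorphicQuotient → ℂ} (hφc : Continuous φ) (hφi : ConstantTermVanishes 𝔓 φ i) {A : ℝ} (hA : 1 < A)
    (hdec : Integrable (fun x => (((supHeight (↥(maximalRealSubfield L)) L (IsCMField.complexConj L) 2 (x)) : ℝ≥0) : ℝ) ^ A * ‖φ x‖) μ) :
    ∫ x, φ x ∂μ = 0 := by
  have hij : (((0 : Fin 2) : ℕ)) + 1 = ((1 : Fin 2) : ℕ) := rfl
  have hN : 2 = 2 * ((0 : Fin 2) : ℕ) + 2 := rfl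
  letI : MeasurableSpace (AdeleRing (𝓞 (↥(maximalRealSubfield L))) (↥(maximalRealSubfield L))) := borel _
  haveI : BorelSpace (AdeleRing (𝓞 (↥(maximalRealSubfield L))) (↥(maximalRealSubfield L))) := ⟨rfl⟩
  obtain ⟨η, hη, C, hC, hmaj⟩ := residue_uniform_majorant_cm_two L hcδ hδ ν h𝓕N h𝓕c 1 hA
  obtain ⟨r, hr, hcont⟩ := sphericalEisenstein_continuation_cm_two L hij hN hcδ hδ ν h𝓕N h𝓕c 1
  have h1 : ∀ σ : ℝ, 1 < σ → σ ≤ 1 + η →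
      Integrable (fun x : (quasiSplit (↥(maximalRealSubfield L)) L (IsCMField.complexConj L) 2).automorphicQuotient => (quasiSplit (↥(maximalRealSubfield L)) L (IsCMField.complexConj L) 2).quotFun (eisensteinSeriesU (flatSectionU (fun _ : (quasiSplit (↥(maximalRealSubfield L)) L (IsCMField.complexConj L) 2).Adelic => (1 : ℂ)) ((σ : ℝ) : ℂ))) x * conj (φ x)) μ ∧ ∫ x, (quasiSplit (↥(maximalRealSubfield L)) L (IsCMField.complexConj L) 2).quotFun (eisensteinSeriesU (flatSectionU (fun _ : (quasiSplit (↥(maximalRealSubfield L)) L (IsCMField.complexConj L) 2).Adelic => (1 : ℂ)) ((σ : ℝ) : ℂ))) x * conj (φ x) ∂μ = 0 := fun σ hσ hση =>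
    integrable_and_integral_quotFun_eisensteinSeriesU_mul_conj_eq_zero_of_constantTermVanishes L ν h𝓕N h𝓕c μ νG 𝔓 i h𝔓 hφc hφi hσ hC (hmaj σ hσ hση) hdec
  have hwin : ∀ᶠ σ : ℝ in 𝓝[>] (1 : ℝ), σ ∈ Ioc (1 : ℝ) (1 + η) := Ioc_mem_nhdsGT (by linarith)
  have hT : Tendsto (fun σ : ℝ => ∫ x, (((σ - 1 : ℝ)) : ℂ) * ((quasiSplit (↥(maximalRealSubfield L)) L (IsCMField.complexConj L) 2).quotFun (eisensteinSeriesU (flatSectionU (fun _ : (quasiSplit (↥(maximalRealSubfield L)) L (IsCMField.complexConj L) 2).Adelic => (1 : ℂ)) ((σ : ℝ) : ℂ))) x * conj (φ x)) ∂μ) (𝓝[>] (1 : ℝ))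
      (𝓝 (∫ x, (1 * r) * conj (φ x) ∂μ)) := by
    refine tendsto_integral_filter_of_dominated_convergence (fun x => C * ((((supHeight (↥(maximalRealSubfield L)) L (IsCMField.complexConj L) 2 (x)) : ℝ≥0) : ℝ) ^ A * ‖φ x‖)) ?_ ?_ (hdec.const_mul C) (ae_of_all _ fun x => ?_)
    · filter_upwards [hwin] with σ hσ
      exact ((h1 σ hσ.1 hσ.2).1.const_mul _).aestronglyMeasurable
    · filter_upwards [hwin] with σ hσ
      refine ae_of_all _ fun x => ?_
      have hm := hmaj σ hσ.1 hσ.2 ((Quotient.out (x) : (quasiSplit (↥(maximalRealSubfield L)) L (IsCMField.complexConj L) 2).Adelic))⁻¹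
      rw [← supHeight_eq_ciSup_out_inv] at hm
      rw [norm_mul, norm_mul, Complex.norm_real, Real.norm_of_nonneg (sub_nonneg.2 hσ.1.le), Complex.norm_conj]
      calc (σ - 1) * (‖(quasiSplit (↥(maximalRealSubfield L)) L (IsCMField.complexConj L) 2).quotFun (eisensteinSeriesU (flatSectionU (fun _ : (quasiSplit (↥(maximalRealSubfield L)) L (IsCMField.complexConj L) 2).Adelic => (1 : ℂ)) ((σ : ℝ) : ℂ))) x‖ * ‖φ x‖) = (σ - 1) * ‖eisensteinSeriesU (flatSectionU (fun _ : (quasiSplit (↥(maximalRealSubfield L)) L (IsCMField.complexConj L) 2).Adelic => (1 : ℂ)) ((σ : ℝ) : ℂ)) ((Quotient.out (x) : (quasiSplit (↥(maximalRealSubfield L)) L (IsCMField.complexConj L) 2).Adelic))⁻¹‖ * ‖φ x‖ := by rw [mul_assoc]; rfl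
        _ ≤ C * (((supHeight (↥(maximalRealSubfield L)) L (IsCMField.complexConj L) 2 (x)) : ℝ≥0) : ℝ) ^ A * ‖φ x‖ := mul_le_mul_of_nonneg_right hm (norm_nonneg _)
        _ = C * ((((supHeight (↥(maximalRealSubfield L)) L (IsCMField.complexConj L) 2 (x)) : ℝ≥0) : ℝ) ^ A * ‖φ x‖) := mul_assoc _ _ _
    · obtain ⟨Ec, -, -, hb, hlim⟩ := hcont ((Quotient.out (x) : (quasiSplit (↥(maximalRealSubfield L)) L (IsCMField.complexConj L) 2).Adelic))⁻¹
      have hT1 := (tendsto_sub_one_mul_eisensteinSeriesU_nhdsGT_one L hb hlim).mul_const (conj (φ x))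
      refine hT1.congr' (Eventually.of_forall fun σ => ?_)
      show (((σ : ℝ) : ℂ) - 1) * eisensteinSeriesU (flatSectionU (fun _ : (quasiSplit (↥(maximalRealSubfield L)) L (IsCMField.complexConj L) 2).Adelic => (1 : ℂ)) ((σ : ℝ) : ℂ)) ((Quotient.out (x) : (quasiSplit (↥(maximalRealSubfield L)) L (IsCMField.complexConj L) 2).Adelic))⁻¹ * conj (φ x) = (((σ - 1 : ℝ)) : ℂ) * ((quasiSplit (↥(maximalRealSubfield L)) L (IsCMField.complexConj L) 2).quotFun (eisensteinSeriesU (flatSectionU (fun _ : (quasiSplit (↥(maximalRealSubfield L)) L (IsCMField.complexConj L) 2).Adelic => (1 : ℂ)) ((σ : ℝ) : ℂ))) x * conj (φ x))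
      push_cast
      rw [mul_assoc]
      rfl
  have hzero : (fun σ : ℝ => ∫ x, (((σ - 1 : ℝ)) : ℂ) * ((quasiSplit (↥(maximalRealSubfield L)) L (IsCMField.complexConj L) 2).quotFun (eisensteinSeriesU (flatSectionU (fun _ : (quasiSplit (↥(maximalRealSubfield L)) L (IsCMField.complexConj L) 2).Adelic => (1 : ℂ)) ((σ : ℝ) : ℂ))) x * conj (φ x)) ∂μ) =ᶠ[𝓝[>] (1 : ℝ)] fun _ => (0 : ℂ) := by
    filter_upwards [hwin] with σ hσ
    rw [integral_const_mul, (h1 σ hσ.1 hσ.2).2, mul_zero]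
  have hI : ∫ x, (1 * r) * conj (φ x) ∂μ = 0 := (tendsto_const_nhds_iff.1 (hT.congr' hzero)).symm
  rw [integral_const_mul, integral_conj, mul_eq_zero] at hI
  have hconj : conj (∫ x, φ x ∂μ) = 0 := hI.resolve_left (by rw [one_mul]; exact hr)
  exact (map_eq_zero_iff (starRingEnd ℂ) (RingHom.injective _)).1 hconj

end Summit.HodgeConjecture.HodgeConjecture.Cruxes.H413.K2E1CuspFormsMeanZeroDecayingCMTwo

end
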